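import Summits.HodgeConjecture.HodgeConjecture.Theorems.F0LD1ThetaTransportKit
import HarnessLib

-- As in the lineage (★ `F0LD1ThetaTransportKit`, ★ `F0LD2MeetsOfNonOrthogonal`): statements over the theta-kernel datum elaborate to very
-- large types; elaborate sequentially.
set_option Elab.async false

/-!
# Crux `HLiu418`, letter (A₂-P♮) — THE ADJUNCTION OF AN `L²`-CLASS WITH THE THETA LIFT FROM A LINE: the typed conclusion
# «`pr_P [Θ̃_Φ(f) ∘ ιA] ≠ 0`» of ★ `Liu2021.curveTheta_nonOrthogonal₂` ⟺ print's «`Θ^W(V) ≠ 0`» [Liu2021, Thm. B.4 (1)(c)]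

Cell hodgecm-mathlib (D-0151), FLOOR 0; crux item `HLiu418` = stmt-HodgeConjecture-24832 (route `HCCMUnconditional`); half-A line LD1 of socket
27458 `Cruxes/HLiu418/Lines/F0_AlbCm.lean` (`stub_S1_facts` = #73, closed BY NAME through `Lines/F0_P6LD_StubS1FactsThetaRoad.lean`, whose one
remaining printed input after ED. 11 (ROAD O) is the letter (A₂-P♮) ★ `Literature/NumberTheory/Automorphic/Liu2021/CurveThetaNonOrthogonal.lean`,
books #184♮).  Seat LD1-p01 (g6), deal of the chair LD1-plan (g3) «HANDS v9» 2026-09-02T14:02:49Z (DEFAULT: residual cheap lemma of #184♮, print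
side) = census `F0/P6/LD/LD2-p02/g4/CENSUS-A2P-inhouse-road.v3.LD2-p02g4.md` §6 row ④ («pairing on the two compact quotients», never typed).
THEOREMS ONLY (no `def`, no instance, no notation, no named fact, no `sorry`); `--supports stmt-HodgeConjecture-24832 --as helper`.  Rank-generic `N`,
ABSTRACT transport `ιA` with the hypothesis pair of ★ `F0LD1ThetaTransportKit` §1 (continuous, rational ↦ rational; the curve letters' PINNED `ιA`
gets them from ★ `F0LD2FrameTransportPin.continuous_of_pin` ∕ `mem_range_toAdelic_of_pin`).  NO invariance of `μW` is used anywhere.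

THE SEAM.  [Liu2021, App. B §B.1 p. 97 L10–18]: «the global theta lifting … for an irreducible smooth subrepresentation `V ⊆ L²_cusp(G)` …
`Θ^W_{μ,V}(V)` is spanned by functions `h ↦ ∫_{G(F)\G(𝔸_F)} θ_μ(g, h) f(g) dg` on `H(F)\H(𝔸_F)` for `f ∈ V`»; and [Thm. B.4 (1)(c) p. 98]: «`Θ^W_{(μ,ν),V}(V_π) ≠ 0`
for some skew-hermitian space `W` of dimension `n + 1 − 2s₀`».  So PRINT's conclusion is the non-vanishing of the lift OF a cusp form `f ∈ V_π` TO `[U(W)]`.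
The tree's letter (A₂-P♮) (and #184 before it) types instead the ADJOINT sentence: the orthogonal projection TO `P` of the class of a theta lift
`x ↦ Θ̃_Φ(f)(ιA x)` OF a continuous weight `f` on `[U(W)]` FROM the line is non-zero.  The dictionary between the two is the adjunction of the two
theta lifts of ONE kernel ([FleigEtAl2018, (12.37)∕(12.38)]; tree ★ `Weil1964.ThetaKernelDatum.integral_thetaLift_mul` for continuous weights on
both sides), here for an `L²`-CLASS `w` on `[U(H)]` against a continuous weight on `[U(⟨a⟩)]`, read through the transport `ιA`:

* §0 the kernel slice on the automorphic quotient, `κ_q := toQuotFun (y ↦ θ_Φ([(ιA y)⁻¹], q))` — the tree's inversion convention of ★ `thetaLiftFun` ∕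
  ★ `toQuotFun` (both evaluate at the inverse), so that in closed form `κ_q [x] = θ_Φ([ιA x], q)` with NO inverse left (`toQuotFun_thetaKer_mk`); the theta class itself is `[x] ↦ ∫ κ_q [x] f(q) dμW(q)` (`toQuotFun_lineThetaLift_eq_integral_toQuotFun_thetaKer`);
  a continuous transport `[ιA] : [U(H)] → [U(diag dV)]` on the quotients exists (`exists_quotientTransport`); the generic pairing formula
  `⟪w, toLp F⟫_{L²(ν)} = ∫ conj(w) · F dν` for a continuous `F` on a compact finite-measure space (`inner_toLp_continuousMap_eq_integral`).
* §1 **(T1) ADJUNCTION** `inner_toLp_lineThetaLift_eq_integral`: for EVERY `w ∈ L²([U(H)], μA)` and every weight `f ∈ C([U(⟨a⟩)], ℂ)`,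
  `⟪w, [Θ̃_Φ(f) ∘ ιA]⟫ = ∫_{[U(⟨a⟩)]} Θᵗ_Φ(w̄)(q) · f(q) dμW(q)`, where `Θᵗ_Φ(w̄)(q) := ∫_{[U(H)]} conj(w α) κ_q(α) dμA(α)` is the OPPOSITE lift of the
  conjugate class — proved WITHOUT Fubini (no product measure, no second countability): `[Θ̃_Φ(f) ∘ ιA]` is `toLp` of the pull-back along `[ιA]` of
  `Θ_Φ(f) = ∫ f(q) • θ_Φ(·, q) dμW(q)`, a `C(·, ℂ)`-VALUED Bochner integral (★ `KernelOp.lift_def`, ★ `KernelOp.lift_pullback`), and the continuous linear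
  functional `Λ_w := F ↦ ⟪w, toLp F⟫ = innerSL ℂ w ∘ ContinuousMap.toLp` commutes with it (Mathlib `ContinuousLinearMap.integral_comp_comm`) — the device of ★
  `KernelOp.integral_lift_mul` with its `pairing ν F` replaced by `Λ_w`; **(T2)** `continuous_oppositeLift`: `q ↦ Θᵗ_Φ(w̄)(q)` is continuous
  (`= Λ_w ∘ sliceQ`), hence a legitimate weight.
* SEQUEL ★-to-be `Theorems/F0LD1ThetaAdjunctionDictionary.lean` (§2, (T3)–(T5)): print (c) ⟹ typed (`w ∈ P`, `Θᵗ_Φ(w̄) ≢ 0` ⟹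
  `pr_P [Θ̃_Φ(conj Θᵗ_Φ(w̄)) ∘ ιA] ≠ 0`), typed ⟹ print (c) (`w := pr_P [Θ̃_Φ(f) ∘ ιA]`), and the `iff` — the typed conclusion of (A₂-P♮) ⟺ print's (c)
  for the complex-conjugate realisation `V = P̄` (the one Liu uses in the proof of [Prop. D.4 (1)], p. 130 last lines).

WHAT THIS BUYS (honest).  Nothing printed is discharged: the load-bearing (a)⇒(c) of [Thm. B.4 (1)] stays PRINTED (census v3: no unitary-group Eisenstein
series ∕ regularised Siegel–Weil carrier in the tree).  The pair of files (i) lets the printed row be re-typed to B.4 (1)(c)'s own sentence with the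
projection form derived as glue, and (ii) certifies (sequel, (T4)∕(T5)) that the typed conclusion is EQUIVALENT to — not stronger than — print's (c).
HC_CM is proved only modulo the 7 printed citations (2 remaining: hLiu418 = stmt-HodgeConjecture-24832, h413 = stmt-HodgeConjecture-24833) until rung 0
closes; count-neutral.

## References
* [Liu2021] Y. Liu, Camb. J. Math. 9 (2021) = arXiv:2102.11518: App. B §B.1 (p. 97 L10–18: the theta lifting `Θ^W_{μ,V}`), Thm. B.4 (1) (p. 98 L8–21),
  App. D proof of Prop. D.4 (1) (p. 130 L(−2) – p. 131 L26).
* [FleigEtAl2018] P. Fleig, H. Gustafsson, A. Kleinschmidt, D. Persson, CUP (2018), §12.3 Def. 12.5 (12.37)–(12.38) p. 296 (the two lifts of one kernel).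
* [DeitmarEchterhoff2014] A. Deitmar, S. Echterhoff, 2nd ed., §B.6 (Bochner integral commutes with bounded functionals).
* [BorelJacquet1979] A. Borel, H. Jacquet, PSPM 33.1 (1979), §4.2, §4.6 (functions on `G(K)\G(𝔸)`, `L²`).
-/

set_option autoImplicit false
-- the mandated namespace has the single-problem summit's repeated segment (`HodgeConjecture.HodgeConjecture`)
set_option linter.dupNamespace false

noncomputable section

open NumberField MeasureTheory IsDedekindDomain
open scoped Matrix ComplexOrder ENNReal InnerProductSpace ComplexConjugate
open Literature.NumberTheory.Automorphic Literature.NumberTheory.Automorphic.UnitaryGroup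
open Literature.NumberTheory.Automorphic.UnitaryGroup.CotangentForms
open Literature.NumberTheory.Automorphic.IdeleClassGroup
open Literature.NumberTheory.Automorphic.Liu2021
open Literature.NumberTheory.Automorphic.Liu2021.Def411WeilCarriers
open Literature.NumberTheory.Automorphic.Liu2021.Def411WeilCarriersDoubling
open Literature.NumberTheory.GelbartRogawski1991 Literature.NumberTheory.GelbartRogawski1991.UnitaryDualPair
open Literature.NumberTheory.Weil1964
open Literature.RepresentationTheory.Liu2021
open Literature.MeasureTheory.Integral

namespace Summit.HodgeConjecture.HodgeConjecture.Cruxes.HLiu418.F0LD1ThetaAdjunctionOfClass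

open _root_.MeasureTheory
open Summit.HodgeConjecture.HodgeConjecture.Cruxes.HLiu418.F0LD1ThetaTransportKit

/-! ## §0 Generic pairing formula; the transport on the quotients; the kernel slice on `[U(H)]` -/

section Generic

variable {A : Type*} [TopologicalSpace A] [CompactSpace A] [MeasurableSpace A] [BorelSpace A] (ν : Measure A) [IsFiniteMeasure ν]

/-- **Pairing of an `L²`-class with a continuous function**: `⟪w, toLp F⟫_{L²(ν)} = ∫ conj(w α) · F(α) dν(α)` (compact `A`, finite `ν`). [folklore]
[cite: BorelJacquet1979, §4.6] -/
theorem inner_toLp_continuousMap_eq_integral (w : Lp ℂ 2 ν) (F : C(A, ℂ)) :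
    ⟪w, ContinuousMap.toLp (E := ℂ) 2 ν ℂ F⟫_ℂ = ∫ α, conj (w α) * F α ∂ν := by
  rw [MeasureTheory.L2.inner_def]
  refine integral_congr_ae ?_
  filter_upwards [ContinuousMap.coeFn_toLp (E := ℂ) (p := 2) (𝕜 := ℂ) ν F] with α hα
  rw [hα, RCLike.inner_apply, mul_comm]

end Generic

section Transport

variable (L : Type) [Field L] [NumberField L] [IsCMField L] (N : ℕ) (H : Matrix (Fin N) (Fin N) L)
  (dV : Fin N → L)
  (ιA : (adelicGroupData (↥(maximalRealSubfield L)) L (IsCMField.complexConj L) N H).Adelic →* ↥(UnitaryGroup.adelic (↥(maximalRealSubfield L)) L (IsCMField.complexConj L) N (Matrix.diagonal dV)))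
  (hιA : Continuous ιA ∧ ∀ ⦃γ : (adelicGroupData (↥(maximalRealSubfield L)) L (IsCMField.complexConj L) N H).Adelic⦄,
    γ ∈ (UnitaryGroup.toAdelic (↥(maximalRealSubfield L)) L (IsCMField.complexConj L) N H).range →
      ιA γ ∈ (UnitaryGroup.toAdelic (↥(maximalRealSubfield L)) L (IsCMField.complexConj L) N (Matrix.diagonal dV)).range)

include hιA

/-- **The transport on the quotients**: a continuous `ιA` carrying rational points to rational points descends to a CONTINUOUS map
`[ιA] : [U(H)] = U(H)(𝔸) ⧸ (A_G · U(H)(L⁺)) → [U(diag dV)] = U(diag dV)(𝔸) ⧸ U(diag dV)(L⁺)` with `[ιA] [x] = [ιA x]` (Mathlib `Quotient.map'`,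
`Continuous.quotient_map'`). [cite: BorelJacquet1979, §4.2] -/
theorem exists_quotientTransport :
    ∃ aQ : C((adelicGroupData (↥(maximalRealSubfield L)) L (IsCMField.complexConj L) N H).automorphicQuotient,
        ↥(UnitaryGroup.adelic (↥(maximalRealSubfield L)) L (IsCMField.complexConj L) N (Matrix.diagonal dV)) ⧸ (UnitaryGroup.toAdelic (↥(maximalRealSubfield L)) L (IsCMField.complexConj L) N (Matrix.diagonal dV)).range),
      ∀ x, aQ ((adelicGroupData (↥(maximalRealSubfield L)) L (IsCMField.complexConj L) N H).toAutomorphicQuotient x) = QuotientGroup.mk (ιA x) := by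
  have hcompat : ∀ x y : (adelicGroupData (↥(maximalRealSubfield L)) L (IsCMField.complexConj L) N H).Adelic,
      @Setoid.r _ (QuotientGroup.leftRel (adelicGroupData (↥(maximalRealSubfield L)) L (IsCMField.complexConj L) N H).quotientSubgroup) x y →
        @Setoid.r _ (QuotientGroup.leftRel (UnitaryGroup.toAdelic (↥(maximalRealSubfield L)) L (IsCMField.complexConj L) N (Matrix.diagonal dV)).range) (ιA x) (ιA y) := by
    intro x y hxy
    rw [QuotientGroup.leftRel_apply] at hxy ⊢
    have h' : x⁻¹ * y ∈ (⊥ : Subgroup (adelicGroupData (↥(maximalRealSubfield L)) L (IsCMField.complexConj L) N H).Adelic) ⊔ (UnitaryGroup.toAdelic (↥(maximalRealSubfield L)) L (IsCMField.complexConj L) N H).range := hxy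
    rw [bot_sup_eq] at h'
    rw [← map_inv, ← map_mul]
    exact hιA.2 h'
  exact ⟨⟨Quotient.map' ιA hcompat, hιA.1.quotient_map' hcompat⟩, fun x => rfl⟩

end Transport

section Slice

variable (L : Type) [Field L] [NumberField L] [IsCMField L] (N : ℕ) (H : Matrix (Fin N) (Fin N) L)
  {n' : ℕ} (e₁ : Fin N × Fin 1 ≃ Fin n') (dV : Fin N → L) (hdV : ∀ i, IsCMField.complexConj L (dV i) = dV i)
  (hdV0 : ∀ i, dV i ≠ 0)
  (ιA : (adelicGroupData (↥(maximalRealSubfield L)) L (IsCMField.complexConj L) N H).Adelic →* ↥(UnitaryGroup.adelic (↥(maximalRealSubfield L)) L (IsCMField.complexConj L) N (Matrix.diagonal dV)))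
  (hιA : Continuous ιA ∧ ∀ ⦃γ : (adelicGroupData (↥(maximalRealSubfield L)) L (IsCMField.complexConj L) N H).Adelic⦄,
    γ ∈ (UnitaryGroup.toAdelic (↥(maximalRealSubfield L)) L (IsCMField.complexConj L) N H).range →
      ιA γ ∈ (UnitaryGroup.toAdelic (↥(maximalRealSubfield L)) L (IsCMField.complexConj L) N (Matrix.diagonal dV)).range)
  (μ : Literature.NumberTheory.Automorphic.IdeleClassGroup L →ₜ* Circle) (hμ : IsConjugateSymplectic L μ) (a : (↥(maximalRealSubfield L))ˣ)
  (hρ : HasThetaMajorants fun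
      (p : ↥(UnitaryGroup.adelic (↥(maximalRealSubfield L)) L (IsCMField.complexConj L) N (Matrix.diagonal dV)) × ↥(UnitaryGroup.adelic (↥(maximalRealSubfield L)) L (IsCMField.complexConj L) 1 (JW (↥(maximalRealSubfield L)) L a))) (Φ : piSchwartzBruhat (↥(maximalRealSubfield L)) (Fin n')) =>
        pairRep (↥(maximalRealSubfield L)) L (IsCMField.complexConj L) N 1 e₁ (Matrix.diagonal dV) (JW (↥(maximalRealSubfield L)) L a)
          (chiSplittingLine L e₁ dV hdV hdV0 (toHeckeCharacter L μ) (isUnitary_toHeckeCharacter L μ)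
            ((isOscillatorChar_toHeckeCharacter_iff μ).mpr hμ) (TW (↥(maximalRealSubfield L)) a)
            (isUnit_det_TW (↥(maximalRealSubfield L)) a) (JW (↥(maximalRealSubfield L)) L a) (JW_eq (↥(maximalRealSubfield L)) L a))
          p Φ)
  (Φ : piSchwartzBruhat (↥(maximalRealSubfield L)) (Fin n'))

include hιA

/-- **The kernel slice on `[U(H)]` in closed form**: the descent `κ_q := toQuotFun (y ↦ θ_Φ([(ιA y)⁻¹], q))` of the theta kernel read along the
transport satisfies `κ_q [x] = θ_Φ([ιA x], q)` (`toQuotFun` evaluates at `x⁻¹`; the inner function is left-`U(H)(L⁺)`-invariant because `ιA` carries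
rational points into `U(diag dV)(L⁺)`, by which the left variable of `θ_Φ` is quotiented). [cite: FleigEtAl2018, §12.3 Def. 12.5 (12.37) p. 296] -/
theorem toQuotFun_thetaKer_mk
    (q : ↥(UnitaryGroup.adelic (↥(maximalRealSubfield L)) L (IsCMField.complexConj L) 1 (JW (↥(maximalRealSubfield L)) L a)) ⧸ (UnitaryGroup.toAdelic (↥(maximalRealSubfield L)) L (IsCMField.complexConj L) 1 (JW (↥(maximalRealSubfield L)) L a)).range)
    (x : (adelicGroupData (↥(maximalRealSubfield L)) L (IsCMField.complexConj L) N H).Adelic) :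
    toQuotFun (adelicGroupData (↥(maximalRealSubfield L)) L (IsCMField.complexConj L) N H)
        (fun y => (lineThetaKernelDatum L N e₁ dV hdV hdV0 μ hμ a hρ).thetaKer Φ (QuotientGroup.mk (ιA y)⁻¹, q))
        ((adelicGroupData (↥(maximalRealSubfield L)) L (IsCMField.complexConj L) N H).toAutomorphicQuotient x) =
      (lineThetaKernelDatum L N e₁ dV hdV hdV0 μ hμ a hρ).thetaKer Φ (QuotientGroup.mk (ιA x), q) := by
  have hinv : ∀ γ ∈ (adelicGroupData (↥(maximalRealSubfield L)) L (IsCMField.complexConj L) N H).quotientSubgroup, ∀ y,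
      (fun y => (lineThetaKernelDatum L N e₁ dV hdV hdV0 μ hμ a hρ).thetaKer Φ (QuotientGroup.mk (ιA y)⁻¹, q)) (γ * y) =
        (fun y => (lineThetaKernelDatum L N e₁ dV hdV hdV0 μ hμ a hρ).thetaKer Φ (QuotientGroup.mk (ιA y)⁻¹, q)) y := by
    intro γ hγ y
    have hγ' : γ ∈ (UnitaryGroup.toAdelic (↥(maximalRealSubfield L)) L (IsCMField.complexConj L) N H).range := by
      have h' : γ ∈ (⊥ : Subgroup (adelicGroupData (↥(maximalRealSubfield L)) L (IsCMField.complexConj L) N H).Adelic) ⊔ (UnitaryGroup.toAdelic (↥(maximalRealSubfield L)) L (IsCMField.complexConj L) N H).range := hγ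
      rwa [bot_sup_eq] at h'
    show (lineThetaKernelDatum L N e₁ dV hdV hdV0 μ hμ a hρ).thetaKer Φ (QuotientGroup.mk (ιA (γ * y))⁻¹, q) =
      (lineThetaKernelDatum L N e₁ dV hdV hdV0 μ hμ a hρ).thetaKer Φ (QuotientGroup.mk (ιA y)⁻¹, q)
    rw [map_mul, mul_inv_rev, QuotientGroup.mk_mul_of_mem _ (inv_mem (hιA.2 hγ'))]
  refine (toQuotFun_mk hinv x).trans ?_
  show (lineThetaKernelDatum L N e₁ dV hdV hdV0 μ hμ a hρ).thetaKer Φ (QuotientGroup.mk (ιA x⁻¹)⁻¹, q) = _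
  rw [map_inv, inv_inv]

/-- **The kernel slice as the pull-back of `θ_Φ` along a transport on the quotients**: for any `aQ` with `aQ [x] = [ιA x]`,
`κ_q α = θ_Φ(aQ α, q)` for every `α ∈ [U(H)]`. [cite: FleigEtAl2018, §12.3 Def. 12.5 (12.37) p. 296] -/
theorem toQuotFun_thetaKer_eq_of_quotientTransport
    (aQ : C((adelicGroupData (↥(maximalRealSubfield L)) L (IsCMField.complexConj L) N H).automorphicQuotient,
        ↥(UnitaryGroup.adelic (↥(maximalRealSubfield L)) L (IsCMField.complexConj L) N (Matrix.diagonal dV)) ⧸ (UnitaryGroup.toAdelic (↥(maximalRealSubfield L)) L (IsCMField.complexConj L) N (Matrix.diagonal dV)).range))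
    (haQ : ∀ x, aQ ((adelicGroupData (↥(maximalRealSubfield L)) L (IsCMField.complexConj L) N H).toAutomorphicQuotient x) = QuotientGroup.mk (ιA x))
    (q : ↥(UnitaryGroup.adelic (↥(maximalRealSubfield L)) L (IsCMField.complexConj L) 1 (JW (↥(maximalRealSubfield L)) L a)) ⧸ (UnitaryGroup.toAdelic (↥(maximalRealSubfield L)) L (IsCMField.complexConj L) 1 (JW (↥(maximalRealSubfield L)) L a)).range)
    (α : (adelicGroupData (↥(maximalRealSubfield L)) L (IsCMField.complexConj L) N H).automorphicQuotient) :
    toQuotFun (adelicGroupData (↥(maximalRealSubfield L)) L (IsCMField.complexConj L) N H)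
        (fun y => (lineThetaKernelDatum L N e₁ dV hdV hdV0 μ hμ a hρ).thetaKer Φ (QuotientGroup.mk (ιA y)⁻¹, q)) α =
      (lineThetaKernelDatum L N e₁ dV hdV hdV0 μ hμ a hρ).thetaKer Φ (aQ α, q) := by
  obtain ⟨x, rfl⟩ := QuotientGroup.mk_surjective α
  rw [show (QuotientGroup.mk x : (adelicGroupData (↥(maximalRealSubfield L)) L (IsCMField.complexConj L) N H).automorphicQuotient) =
      (adelicGroupData (↥(maximalRealSubfield L)) L (IsCMField.complexConj L) N H).toAutomorphicQuotient x from rfl,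
    toQuotFun_thetaKer_mk L N H e₁ dV hdV hdV0 ιA hιA μ hμ a hρ Φ q x, haQ]

variable
  [CompactSpace (↥(UnitaryGroup.adelic (↥(maximalRealSubfield L)) L (IsCMField.complexConj L) N (Matrix.diagonal dV)) ⧸ (UnitaryGroup.toAdelic (↥(maximalRealSubfield L)) L (IsCMField.complexConj L) N (Matrix.diagonal dV)).range)]
  [MeasurableSpace (↥(UnitaryGroup.adelic (↥(maximalRealSubfield L)) L (IsCMField.complexConj L) 1 (JW (↥(maximalRealSubfield L)) L a)) ⧸ (UnitaryGroup.toAdelic (↥(maximalRealSubfield L)) L (IsCMField.complexConj L) 1 (JW (↥(maximalRealSubfield L)) L a)).range)]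
  [BorelSpace (↥(UnitaryGroup.adelic (↥(maximalRealSubfield L)) L (IsCMField.complexConj L) 1 (JW (↥(maximalRealSubfield L)) L a)) ⧸ (UnitaryGroup.toAdelic (↥(maximalRealSubfield L)) L (IsCMField.complexConj L) 1 (JW (↥(maximalRealSubfield L)) L a)).range)]
  (μW : Measure (↥(UnitaryGroup.adelic (↥(maximalRealSubfield L)) L (IsCMField.complexConj L) 1 (JW (↥(maximalRealSubfield L)) L a)) ⧸ (UnitaryGroup.toAdelic (↥(maximalRealSubfield L)) L (IsCMField.complexConj L) 1 (JW (↥(maximalRealSubfield L)) L a)).range))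
  [IsFiniteMeasure μW]

/-- **The theta class through the kernel slice**: `[Θ̃_Φ(f) ∘ ιA](α) = ∫ κ_q(α) f(q) dμW(q)` at every point of `[U(H)]` — literally the defining
integral `Θ_Φ(f)(ξ) = ∫ θ_Φ(ξ, q) f(q) dμW(q)` (★ `thetaLift_apply`) at `ξ = [ιA x]`. [cite: FleigEtAl2018, §12.3 Def. 12.5 (12.37) p. 296] -/
theorem toQuotFun_lineThetaLift_eq_integral_toQuotFun_thetaKer
    (f : C((↥(UnitaryGroup.adelic (↥(maximalRealSubfield L)) L (IsCMField.complexConj L) 1 (JW (↥(maximalRealSubfield L)) L a)) ⧸ (UnitaryGroup.toAdelic (↥(maximalRealSubfield L)) L (IsCMField.complexConj L) 1 (JW (↥(maximalRealSubfield L)) L a)).range), ℂ))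
    (α : (adelicGroupData (↥(maximalRealSubfield L)) L (IsCMField.complexConj L) N H).automorphicQuotient) :
    toQuotFun (adelicGroupData (↥(maximalRealSubfield L)) L (IsCMField.complexConj L) N H)
        (fun y => (lineThetaKernelDatum L N e₁ dV hdV hdV0 μ hμ a hρ).thetaLiftFun μW Φ f (ιA y)) α =
      ∫ q, toQuotFun (adelicGroupData (↥(maximalRealSubfield L)) L (IsCMField.complexConj L) N H)
          (fun y => (lineThetaKernelDatum L N e₁ dV hdV hdV0 μ hμ a hρ).thetaKer Φ (QuotientGroup.mk (ιA y)⁻¹, q)) α * f q ∂μW := by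
  haveI := compactSpace_quotient_range_toAdelic_JW L a
  obtain ⟨x, rfl⟩ := QuotientGroup.mk_surjective α
  rw [show (QuotientGroup.mk x : (adelicGroupData (↥(maximalRealSubfield L)) L (IsCMField.complexConj L) N H).automorphicQuotient) =
      (adelicGroupData (↥(maximalRealSubfield L)) L (IsCMField.complexConj L) N H).toAutomorphicQuotient x from rfl,
    toQuotFun_lineThetaLift_mk L N H e₁ dV hdV hdV0 ιA hιA μ hμ a hρ μW Φ f x,
    (lineThetaKernelDatum L N e₁ dV hdV hdV0 μ hμ a hρ).thetaLift_apply μW Φ f]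
  refine integral_congr_ae (Filter.Eventually.of_forall fun q => ?_)
  dsimp only
  rw [toQuotFun_thetaKer_mk L N H e₁ dV hdV hdV0 ιA hιA μ hμ a hρ Φ q x]

end Slice

/-! ## §1 (T1) the adjunction and (T2) continuity of the opposite lift -/

section Adjunction

variable (L : Type) [Field L] [NumberField L] [IsCMField L] (N : ℕ) (H : Matrix (Fin N) (Fin N) L)
  {n' : ℕ} (e₁ : Fin N × Fin 1 ≃ Fin n') (dV : Fin N → L) (hdV : ∀ i, IsCMField.complexConj L (dV i) = dV i)
  (hdV0 : ∀ i, dV i ≠ 0)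
  (ιA : (adelicGroupData (↥(maximalRealSubfield L)) L (IsCMField.complexConj L) N H).Adelic →* ↥(UnitaryGroup.adelic (↥(maximalRealSubfield L)) L (IsCMField.complexConj L) N (Matrix.diagonal dV)))
  (hιA : Continuous ιA ∧ ∀ ⦃γ : (adelicGroupData (↥(maximalRealSubfield L)) L (IsCMField.complexConj L) N H).Adelic⦄,
    γ ∈ (UnitaryGroup.toAdelic (↥(maximalRealSubfield L)) L (IsCMField.complexConj L) N H).range →
      ιA γ ∈ (UnitaryGroup.toAdelic (↥(maximalRealSubfield L)) L (IsCMField.complexConj L) N (Matrix.diagonal dV)).range)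
  (μ : Literature.NumberTheory.Automorphic.IdeleClassGroup L →ₜ* Circle) (hμ : IsConjugateSymplectic L μ) (a : (↥(maximalRealSubfield L))ˣ)
  (hρ : HasThetaMajorants fun
      (p : ↥(UnitaryGroup.adelic (↥(maximalRealSubfield L)) L (IsCMField.complexConj L) N (Matrix.diagonal dV)) × ↥(UnitaryGroup.adelic (↥(maximalRealSubfield L)) L (IsCMField.complexConj L) 1 (JW (↥(maximalRealSubfield L)) L a))) (Φ : piSchwartzBruhat (↥(maximalRealSubfield L)) (Fin n')) =>
        pairRep (↥(maximalRealSubfield L)) L (IsCMField.complexConj L) N 1 e₁ (Matrix.diagonal dV) (JW (↥(maximalRealSubfield L)) L a)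
          (chiSplittingLine L e₁ dV hdV hdV0 (toHeckeCharacter L μ) (isUnitary_toHeckeCharacter L μ)
            ((isOscillatorChar_toHeckeCharacter_iff μ).mpr hμ) (TW (↥(maximalRealSubfield L)) a)
            (isUnit_det_TW (↥(maximalRealSubfield L)) a) (JW (↥(maximalRealSubfield L)) L a) (JW_eq (↥(maximalRealSubfield L)) L a))
          p Φ)
  [CompactSpace (↥(UnitaryGroup.adelic (↥(maximalRealSubfield L)) L (IsCMField.complexConj L) N (Matrix.diagonal dV)) ⧸ (UnitaryGroup.toAdelic (↥(maximalRealSubfield L)) L (IsCMField.complexConj L) N (Matrix.diagonal dV)).range)]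
  [MeasurableSpace (↥(UnitaryGroup.adelic (↥(maximalRealSubfield L)) L (IsCMField.complexConj L) 1 (JW (↥(maximalRealSubfield L)) L a)) ⧸ (UnitaryGroup.toAdelic (↥(maximalRealSubfield L)) L (IsCMField.complexConj L) 1 (JW (↥(maximalRealSubfield L)) L a)).range)]
  [BorelSpace (↥(UnitaryGroup.adelic (↥(maximalRealSubfield L)) L (IsCMField.complexConj L) 1 (JW (↥(maximalRealSubfield L)) L a)) ⧸ (UnitaryGroup.toAdelic (↥(maximalRealSubfield L)) L (IsCMField.complexConj L) 1 (JW (↥(maximalRealSubfield L)) L a)).range)]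
  (μW : Measure (↥(UnitaryGroup.adelic (↥(maximalRealSubfield L)) L (IsCMField.complexConj L) 1 (JW (↥(maximalRealSubfield L)) L a)) ⧸ (UnitaryGroup.toAdelic (↥(maximalRealSubfield L)) L (IsCMField.complexConj L) 1 (JW (↥(maximalRealSubfield L)) L a)).range))
  [IsFiniteMeasure μW]
  (Φ : piSchwartzBruhat (↥(maximalRealSubfield L)) (Fin n'))
  {μA : Measure (adelicGroupData (↥(maximalRealSubfield L)) L (IsCMField.complexConj L) N H).automorphicQuotient}
  [(adelicGroupData (↥(maximalRealSubfield L)) L (IsCMField.complexConj L) N H).IsAutomorphicMeasure μA]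
  [CompactSpace (adelicGroupData (↥(maximalRealSubfield L)) L (IsCMField.complexConj L) N H).automorphicQuotient]

include hιA

/-- **(T1) THE ADJUNCTION.**  For every `L²`-class `w` on `[U(H)]` and every continuous weight `f` on `[U(⟨a⟩)]`,
`⟪w, [Θ̃_Φ(f) ∘ ιA]⟫_{L²(μA)} = ∫_{[U(⟨a⟩)]} Θᵗ_Φ(w̄)(q) · f(q) dμW(q)`, with the opposite lift `Θᵗ_Φ(w̄)(q) := ∫_{[U(H)]} conj(w α) κ_q(α) dμA(α)`
(`κ_q` the kernel slice of §0: `κ_q [x] = θ_Φ([ιA x], q)`).  The two theta lifts of one kernel are adjoint [FleigEtAl2018, (12.37)∕(12.38)]; here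
one weight is an `L²`-CLASS, and the proof uses no product measure: `[Θ̃_Φ(f) ∘ ιA] = toLp ((Θ_Φ f) ∘ [ιA])`, `(Θ_Φ f) ∘ [ιA] = ∫ f(q) • κ_q dμW(q)` as a
`C([U(H)], ℂ)`-valued Bochner integral (★ `KernelOp.lift_def`, ★ `KernelOp.lift_pullback`), and the continuous linear functional
`F ↦ ⟪w, toLp F⟫ = innerSL ℂ w ∘ ContinuousMap.toLp` commutes with that integral (Mathlib `ContinuousLinearMap.integral_comp_comm`).
[cite: FleigEtAl2018, §12.3 Def. 12.5 (12.37)–(12.38) p. 296] [cite: DeitmarEchterhoff2014, §B.6] [cite: Liu2021, App. B §B.1 (p. 97 L10–18)] -/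
theorem inner_toLp_lineThetaLift_eq_integral
    (f : C((↥(UnitaryGroup.adelic (↥(maximalRealSubfield L)) L (IsCMField.complexConj L) 1 (JW (↥(maximalRealSubfield L)) L a)) ⧸ (UnitaryGroup.toAdelic (↥(maximalRealSubfield L)) L (IsCMField.complexConj L) 1 (JW (↥(maximalRealSubfield L)) L a)).range), ℂ))
    (w : (adelicGroupData (↥(maximalRealSubfield L)) L (IsCMField.complexConj L) N H).L2 μA) :
    ⟪w, MemLp.toLp _ (memLp_toQuotFun_lineThetaLift L N H e₁ dV hdV hdV0 ιA hιA μ hμ a hρ μW Φ f μA 2)⟫_ℂ =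
      ∫ q, (∫ α, conj (w α) * toQuotFun (adelicGroupData (↥(maximalRealSubfield L)) L (IsCMField.complexConj L) N H)
          (fun y => (lineThetaKernelDatum L N e₁ dV hdV hdV0 μ hμ a hρ).thetaKer Φ (QuotientGroup.mk (ιA y)⁻¹, q)) α ∂μA) * f q ∂μW := by
  haveI := compactSpace_quotient_range_toAdelic_JW L a
  -- the transport on the quotients and the pulled-back kernel `K' (α, q) = κ_q α`
  obtain ⟨aQ, haQ⟩ := exists_quotientTransport L N H dV ιA hιA
  set K' : C((adelicGroupData (↥(maximalRealSubfield L)) L (IsCMField.complexConj L) N H).automorphicQuotient ×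
      (↥(UnitaryGroup.adelic (↥(maximalRealSubfield L)) L (IsCMField.complexConj L) 1 (JW (↥(maximalRealSubfield L)) L a)) ⧸ (UnitaryGroup.toAdelic (↥(maximalRealSubfield L)) L (IsCMField.complexConj L) 1 (JW (↥(maximalRealSubfield L)) L a)).range), ℂ) :=
    ((lineThetaKernelDatum L N e₁ dV hdV hdV0 μ hμ a hρ).thetaKer Φ).comp (aQ.prodMap (ContinuousMap.id _)) with hK'
  have hκ : ∀ α q, toQuotFun (adelicGroupData (↥(maximalRealSubfield L)) L (IsCMField.complexConj L) N H)
      (fun y => (lineThetaKernelDatum L N e₁ dV hdV hdV0 μ hμ a hρ).thetaKer Φ (QuotientGroup.mk (ιA y)⁻¹, q)) α = K' (α, q) := fun α q =>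
    toQuotFun_thetaKer_eq_of_quotientTransport L N H e₁ dV hdV hdV0 ιA hιA μ hμ a hρ Φ aQ haQ q α
  -- the class `[Θ̃_Φ(f) ∘ ιA]` is `toLp` of the continuous function `lift μW K' f = (Θ_Φ f) ∘ aQ`
  have hF : (toQuotFun (adelicGroupData (↥(maximalRealSubfield L)) L (IsCMField.complexConj L) N H)
      fun y => (lineThetaKernelDatum L N e₁ dV hdV hdV0 μ hμ a hρ).thetaLiftFun μW Φ f (ιA y)) = ⇑(KernelOp.lift μW K' f) := by
    funext α
    obtain ⟨x, rfl⟩ := QuotientGroup.mk_surjective α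
    rw [hK', KernelOp.lift_pullback, ContinuousMap.comp_apply,
      show (QuotientGroup.mk x : (adelicGroupData (↥(maximalRealSubfield L)) L (IsCMField.complexConj L) N H).automorphicQuotient) =
        (adelicGroupData (↥(maximalRealSubfield L)) L (IsCMField.complexConj L) N H).toAutomorphicQuotient x from rfl,
      toQuotFun_lineThetaLift_mk L N H e₁ dV hdV hdV0 ιA hιA μ hμ a hρ μW Φ f x, haQ,
      (lineThetaKernelDatum L N e₁ dV hdV hdV0 μ hμ a hρ).thetaLift_def μW Φ f]
  have hclass : MemLp.toLp _ (memLp_toQuotFun_lineThetaLift L N H e₁ dV hdV hdV0 ιA hιA μ hμ a hρ μW Φ f μA 2) =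
      ContinuousMap.toLp (E := ℂ) 2 μA ℂ (KernelOp.lift μW K' f) :=
    Lp.ext ((MemLp.coeFn_toLp _).trans (by
      rw [hF]
      exact (ContinuousMap.coeFn_toLp (E := ℂ) (p := 2) (𝕜 := ℂ) μA (KernelOp.lift μW K' f)).symm))
  -- the functional `Λ_w = ⟪w, toLp ·⟫` commutes with the `C([U(H)], ℂ)`-valued integral
  set Λ : C((adelicGroupData (↥(maximalRealSubfield L)) L (IsCMField.complexConj L) N H).automorphicQuotient, ℂ) →L[ℂ] ℂ :=
    (innerSL ℂ w).comp (ContinuousMap.toLp (E := ℂ) 2 μA ℂ) with hΛ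
  have hΛap : ∀ F, Λ F = ⟪w, ContinuousMap.toLp (E := ℂ) 2 μA ℂ F⟫_ℂ := fun F => by
    rw [hΛ, ContinuousLinearMap.comp_apply, innerSL_apply_apply]
  rw [hclass, ← hΛap, KernelOp.lift_def, ← Λ.integral_comp_comm (KernelOp.integrable_smul_sliceQ_id μW K' f)]
  refine integral_congr_ae (Filter.Eventually.of_forall fun q => ?_)
  dsimp only
  rw [map_smul, smul_eq_mul, hΛap, inner_toLp_continuousMap_eq_integral, mul_comm]
  congr 1
  refine integral_congr_ae (Filter.Eventually.of_forall fun α => ?_)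
  dsimp only
  rw [KernelOp.sliceQ_apply, hκ]

omit
  [CompactSpace (↥(UnitaryGroup.adelic (↥(maximalRealSubfield L)) L (IsCMField.complexConj L) N (Matrix.diagonal dV)) ⧸ (UnitaryGroup.toAdelic (↥(maximalRealSubfield L)) L (IsCMField.complexConj L) N (Matrix.diagonal dV)).range)]
  [MeasurableSpace (↥(UnitaryGroup.adelic (↥(maximalRealSubfield L)) L (IsCMField.complexConj L) 1 (JW (↥(maximalRealSubfield L)) L a)) ⧸ (UnitaryGroup.toAdelic (↥(maximalRealSubfield L)) L (IsCMField.complexConj L) 1 (JW (↥(maximalRealSubfield L)) L a)).range)]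
  [BorelSpace (↥(UnitaryGroup.adelic (↥(maximalRealSubfield L)) L (IsCMField.complexConj L) 1 (JW (↥(maximalRealSubfield L)) L a)) ⧸ (UnitaryGroup.toAdelic (↥(maximalRealSubfield L)) L (IsCMField.complexConj L) 1 (JW (↥(maximalRealSubfield L)) L a)).range)] in
/-- **(T2) THE OPPOSITE LIFT IS A CONTINUOUS WEIGHT**: `q ↦ Θᵗ_Φ(w̄)(q) = ∫_{[U(H)]} conj(w α) κ_q(α) dμA(α)` is continuous on `[U(⟨a⟩)]`
(`= Λ_w ∘ sliceQ` with `Λ_w` continuous linear and `q ↦ θ_Φ([ιA ·], q) ∈ C([U(H)], ℂ)` continuous, ★ `KernelOp.sliceQ`).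
[cite: FleigEtAl2018, §12.3 (12.38) p. 296] [cite: DeitmarEchterhoff2014, §B.6] -/
theorem continuous_oppositeLift (w : (adelicGroupData (↥(maximalRealSubfield L)) L (IsCMField.complexConj L) N H).L2 μA) :
    Continuous fun q => ∫ α, conj (w α) * toQuotFun (adelicGroupData (↥(maximalRealSubfield L)) L (IsCMField.complexConj L) N H)
      (fun y => (lineThetaKernelDatum L N e₁ dV hdV hdV0 μ hμ a hρ).thetaKer Φ (QuotientGroup.mk (ιA y)⁻¹, q)) α ∂μA := by
  obtain ⟨aQ, haQ⟩ := exists_quotientTransport L N H dV ιA hιA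
  set K' : C((adelicGroupData (↥(maximalRealSubfield L)) L (IsCMField.complexConj L) N H).automorphicQuotient ×
      (↥(UnitaryGroup.adelic (↥(maximalRealSubfield L)) L (IsCMField.complexConj L) 1 (JW (↥(maximalRealSubfield L)) L a)) ⧸ (UnitaryGroup.toAdelic (↥(maximalRealSubfield L)) L (IsCMField.complexConj L) 1 (JW (↥(maximalRealSubfield L)) L a)).range), ℂ) :=
    ((lineThetaKernelDatum L N e₁ dV hdV hdV0 μ hμ a hρ).thetaKer Φ).comp (aQ.prodMap (ContinuousMap.id _)) with hK'
  have hκ : ∀ α q, toQuotFun (adelicGroupData (↥(maximalRealSubfield L)) L (IsCMField.complexConj L) N H)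
      (fun y => (lineThetaKernelDatum L N e₁ dV hdV hdV0 μ hμ a hρ).thetaKer Φ (QuotientGroup.mk (ιA y)⁻¹, q)) α = K' (α, q) := fun α q =>
    toQuotFun_thetaKer_eq_of_quotientTransport L N H e₁ dV hdV hdV0 ιA hιA μ hμ a hρ Φ aQ haQ q α
  set Λ : C((adelicGroupData (↥(maximalRealSubfield L)) L (IsCMField.complexConj L) N H).automorphicQuotient, ℂ) →L[ℂ] ℂ :=
    (innerSL ℂ w).comp (ContinuousMap.toLp (E := ℂ) 2 μA ℂ) with hΛ
  have heq : (fun q => ∫ α, conj (w α) * toQuotFun (adelicGroupData (↥(maximalRealSubfield L)) L (IsCMField.complexConj L) N H)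
      (fun y => (lineThetaKernelDatum L N e₁ dV hdV hdV0 μ hμ a hρ).thetaKer Φ (QuotientGroup.mk (ιA y)⁻¹, q)) α ∂μA) =
      fun q => Λ (KernelOp.sliceQ K' q) := by
    funext q
    rw [hΛ, ContinuousLinearMap.comp_apply, innerSL_apply_apply, inner_toLp_continuousMap_eq_integral]
    refine integral_congr_ae (Filter.Eventually.of_forall fun α => ?_)
    dsimp only
    rw [KernelOp.sliceQ_apply, hκ]
  rw [heq]
  exact Λ.continuous.comp (KernelOp.sliceQ K').continuous

end Adjunction

end Summit.HodgeConjecture.HodgeConjecture.Cruxes.HLiu418.F0LD1ThetaAdjunctionOfClass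

end
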